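import Summits.CriticalPhenomena.Ising3DConformalLimit.Theses.PrecisionLaplacian
import Summits.CriticalPhenomena.Ising3DConformalLimit.Theorems.MoebiusLimitOfTwoPointLaw.Negative.GroupLemmaNeedsTranslation
import Summits.CriticalPhenomena.Ising3DConformalLimit.Theorems.MoebiusLimitOfTwoPointLaw.Negative.TwoPointConvergence
import HarnessLib

/-!
# Two-shell exchange: the FREE members of the hierarchy `E_{k,m}` (line `two-shell-exchange-markov` of crux
`MoebiusLimitOfTwoPointLaw`, item stmt-CriticalPhenomena-4801; helper for stub `stub_twoTimeSymmetry`)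

The registered stub K1 (`stub_twoTimeSymmetry`, skeleton
`Cruxes/MoebiusLimitOfTwoPointLaw/Lines/two_shell_exchange_markov.lean`) asks that every regular pointwise
scaling limit `S` of the critical `ℤ³` correlators under the two-point law lies in
`Negative.twoShellExchange Δ`: for unit directions `u_i`, a marking `inner : Fin n → Bool` of `k` inner and
`m = n - k` outer points and radii `0 < a, b`,
`S_n((inner ↦ b, outer ↦ a) • u) = (a/b)^{(k-m)Δ} · S_n((inner ↦ a, outer ↦ b) • u)`.

This file proves, `sorry`-free, the members of the hierarchy that are FREE — they follow from hypotheses K1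
already carries — and isolates the irreducible member:

* `exchange_of_all_inner`, `exchange_of_all_outer`: ONE-SHELL markings (`k = 0` or `m = 0`) are dilations
  (`IsScaleCovariant Δ S`);
* `exchange_of_odd`: ODD arities, because odd critical correlators of `ℤ³` vanish
  (`Negative.rescaledCorrelator_arity_odd`, i.e. `criticalCorr_eq_zero_of_odd`, `m*(β_c(3)) = 0`) and pointwise
  limits are unique (`odd_eq_zero_of_limit`), plus the normalisation off `NonCoincident`;
* `exchange_two`: arity `2`, all four markings, from the identified two-point function
  `S₂ = c'‖a−b‖^{-2Δ}` (`Negative.twoPoint_exchange_of_twoPointLaw`) and the normalisation at coincidences;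
* `stub_twoTimeSymmetry_free`: K1 with the extra hypothesis "odd `n`, or `n ≤ 2`, or a one-shell marking";
* `mem_twoShellExchange_iff_core`: K1 is EQUIVALENT to its restriction to even `n ≥ 4` with both shells
  occupied (`∃ i, inner i = true`, `∃ j, inner j = false`) — the member `E_{k,m}`, `k, m ≥ 1`, `k + m` even
  `≥ 4`, i.e. unit-inversion covariance of the `ℤ³` limit on two-sphere configurations (Disproof §3c: at
  `n = 4` this is clause (c) of the crux at `n = 4`), for which the line has no engine.

References: crux workfile `Cruxes/MoebiusLimitOfTwoPointLaw/Disproof.lean` §3a/§3c; Di Francesco–Mathieu–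
Sénéchal 1997 §4.3.1 (covariance of quasi-primary correlators) [FrancescoMathieuSenechal1997].
-/

noncomputable section

namespace Summit.CriticalPhenomena.Ising3DConformalLimit.PrecisionLaplacianMoebiusLimitOfTwoPointLaw

open Literature.Probability.LatticeModels Filter Topology
open Summit.CriticalPhenomena.Ising3DConformalLimit.Theorems.MoebiusLimitOfTwoPointLaw.Negative
  (twoShellExchange twoPoint_exchange_of_twoPointLaw rescaledCorrelator_arity_odd)

variable {Δ : ℝ} {S : CorrFamily 3}

/-- Membership in `twoShellExchange Δ` is the conjunction of all exchange identities (by `Iff.rfl`). -/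
theorem mem_twoShellExchange_iff :
    S ∈ twoShellExchange Δ ↔ ∀ (n : ℕ) (a b : ℝ), 0 < a → 0 < b →
      ∀ (u : Fin n → EuclideanSpace ℝ (Fin 3)) (inner : Fin n → Bool), (∀ i, ‖u i‖ = 1) →
        (S n (fun i => (if inner i then b else a) • u i)
          = (a / b) ^ ((((Finset.univ.filter fun i => inner i = true).card : ℝ)
              - ((Finset.univ.filter fun i => inner i = false).card : ℝ)) * Δ)
            * S n (fun i => (if inner i then a else b) • u i)) :=
  Iff.rfl

/-! ## One-shell markings: dilations -/

/-- All points inner (`m = 0`): the identity is the dilation by `a/b`. -/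
theorem exchange_of_all_inner (hsc : IsScaleCovariant Δ S) {n : ℕ} {a b : ℝ} (ha : 0 < a) (hb : 0 < b)
    (u : Fin n → EuclideanSpace ℝ (Fin 3)) {inner : Fin n → Bool} (h : ∀ i, inner i = true) :
    (S n (fun i => (if inner i then b else a) • u i)
          = (a / b) ^ ((((Finset.univ.filter fun i => inner i = true).card : ℝ)
              - ((Finset.univ.filter fun i => inner i = false).card : ℝ)) * Δ)
            * S n (fun i => (if inner i then a else b) • u i)) := by
  have hab : 0 < a / b := div_pos ha hb
  have hL : (fun i => (if inner i then b else a) • u i) = fun i => b • u i := by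
    funext i; simp [h i]
  have hR : (fun i => (if inner i then a else b) • u i) = fun i => (a / b) • (b • u i) := by
    funext i
    simp only [h i, if_true, smul_smul]
    congr 1
    field_simp
  have hk : (Finset.univ.filter fun i => inner i = true).card = n := by
    rw [Finset.filter_true_of_mem fun i _ => h i, Finset.card_univ, Fintype.card_fin]
  have hm : (Finset.univ.filter fun i => inner i = false).card = 0 := by
    rw [Finset.card_eq_zero, Finset.filter_eq_empty_iff]
    intro i _
    simp [h i]
  rw [hk, hm, hL, hR, hsc n (a / b) hab, ← mul_assoc, ← Real.rpow_add hab]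
  simp

/-- All points outer (`k = 0`): the identity is the dilation by `a/b` read backwards. -/
theorem exchange_of_all_outer (hsc : IsScaleCovariant Δ S) {n : ℕ} {a b : ℝ} (ha : 0 < a) (hb : 0 < b)
    (u : Fin n → EuclideanSpace ℝ (Fin 3)) {inner : Fin n → Bool} (h : ∀ i, inner i = false) :
    (S n (fun i => (if inner i then b else a) • u i)
          = (a / b) ^ ((((Finset.univ.filter fun i => inner i = true).card : ℝ)
              - ((Finset.univ.filter fun i => inner i = false).card : ℝ)) * Δ)
            * S n (fun i => (if inner i then a else b) • u i)) := by
  have hab : 0 < a / b := div_pos ha hb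
  have hL : (fun i => (if inner i then b else a) • u i) = fun i => (a / b) • (b • u i) := by
    funext i
    simp only [h i, Bool.false_eq_true, if_false, smul_smul]
    congr 1
    field_simp
  have hR : (fun i => (if inner i then a else b) • u i) = fun i => b • u i := by
    funext i; simp [h i]
  have hk : (Finset.univ.filter fun i => inner i = true).card = 0 := by
    rw [Finset.card_eq_zero, Finset.filter_eq_empty_iff]
    intro i _
    simp [h i]
  have hm : (Finset.univ.filter fun i => inner i = false).card = n := by
    rw [Finset.filter_true_of_mem fun i _ => h i, Finset.card_univ, Fintype.card_fin]
  rw [hk, hm, hL, hR, hsc n (a / b) hab]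
  congr 1
  push_cast
  ring_nf

/-! ## Odd arities -/

/-- Odd arities of a pointwise scaling limit of the critical `ℤ³` correlators vanish identically (on
`NonCoincident` by `m*(β_c(3)) = 0` and uniqueness of limits, off it by the normalisation). -/
theorem odd_eq_zero_of_limit {ρ : ℝ → ℝ} (hlim : HasPointwiseScalingLimit (criticalCorr 3) ρ S)
    (hnorm : ∀ n z, z ∉ NonCoincident 3 n → S n z = 0) {n : ℕ} (hn : Odd n)
    (x : Fin n → EuclideanSpace ℝ (Fin 3)) : S n x = 0 := by
  by_cases hx : x ∈ NonCoincident 3 n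
  · have h1 : Tendsto (fun δ => rescaledCorrelator (criticalCorr 3) ρ n δ x) (𝓝[>] 0) (𝓝 (S n x)) :=
      (hlim n).tendsto_at hx
    have h2 : Tendsto (fun δ => rescaledCorrelator (criticalCorr 3) ρ n δ x) (𝓝[>] 0) (𝓝 0) := by
      simp only [rescaledCorrelator_arity_odd ρ hn]
      exact tendsto_const_nhds
    exact tendsto_nhds_unique h1 h2
  · exact hnorm n x hx

/-- Odd arities: both sides of the identity vanish. -/
theorem exchange_of_odd (hodd : ∀ n, Odd n → ∀ x : Fin n → EuclideanSpace ℝ (Fin 3), S n x = 0)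
    {n : ℕ} (hn : Odd n) (a b : ℝ) (u : Fin n → EuclideanSpace ℝ (Fin 3)) (inner : Fin n → Bool) :
    (S n (fun i => (if inner i then b else a) • u i)
          = (a / b) ^ ((((Finset.univ.filter fun i => inner i = true).card : ℝ)
              - ((Finset.univ.filter fun i => inner i = false).card : ℝ)) * Δ)
            * S n (fun i => (if inner i then a else b) • u i)) := by
  rw [hodd n hn, hodd n hn, mul_zero]

/-! ## Arity two -/

/-- A `Fin 2`-configuration is the matrix literal of its two values. -/
theorem fin_two_eq (x : Fin 2 → EuclideanSpace ℝ (Fin 3)) : x = ![x 0, x 1] := by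
  funext i; fin_cases i <;> rfl

/-- Arity `2`, all four markings: one-shell markings are dilations, mixed markings are the `(1,1)` member
given by the identified two-point function (and by the normalisation at the coincidence `a u₀ = b u₁`). -/
theorem exchange_two (hsc : IsScaleCovariant Δ S) (hnorm : ∀ n z, z ∉ NonCoincident 3 n → S n z = 0)
    {c' : ℝ} (h2pt : ∀ p q : EuclideanSpace ℝ (Fin 3), p ≠ q → S 2 ![p, q] = c' * ‖p - q‖ ^ (-(2 * Δ)))
    {a b : ℝ} (ha : 0 < a) (hb : 0 < b) (u : Fin 2 → EuclideanSpace ℝ (Fin 3)) (inner : Fin 2 → Bool)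
    (hu : ∀ i, ‖u i‖ = 1) : (S 2 (fun i => (if inner i then b else a) • u i)
          = (a / b) ^ ((((Finset.univ.filter fun i => inner i = true).card : ℝ)
              - ((Finset.univ.filter fun i => inner i = false).card : ℝ)) * Δ)
            * S 2 (fun i => (if inner i then a else b) • u i)) := by
  -- the four markings
  rcases h0 : inner 0 with _ | _ <;> rcases h1 : inner 1 with _ | _
  · exact exchange_of_all_outer hsc ha hb u (fun i => by fin_cases i <;> assumption)
  · -- inner = (false, true): k = m = 1, weight 1
    have hk : (Finset.univ.filter fun i => inner i = true).card = 1 := by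
      rw [Finset.card_eq_one]; refine ⟨1, ?_⟩; ext i; fin_cases i <;> simp [h0, h1]
    have hm : (Finset.univ.filter fun i => inner i = false).card = 1 := by
      rw [Finset.card_eq_one]; refine ⟨0, ?_⟩; ext i; fin_cases i <;> simp [h0, h1]
    rw [hk, hm, sub_self, zero_mul, Real.rpow_zero, one_mul,
      fin_two_eq (fun i => (if inner i then b else a) • u i),
      fin_two_eq (fun i => (if inner i then a else b) • u i)]
    simp only [h0, h1, Bool.false_eq_true, if_false, if_true]
    by_cases hne : b • u 0 ≠ a • u 1
    · -- `‖a u₀ − b u₁‖ = ‖b u₀ − a u₁‖`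
      exact twoPoint_exchange_of_twoPointLaw c' Δ S h2pt b a (u 0) (u 1) (hu 0) (hu 1) hne
    · push Not at hne
      -- coincidence: then `a = b` and `u₀ = u₁`, both configurations are coincident
      have hab : b = a := by
        have := congrArg (fun v => ‖v‖) hne
        simpa [norm_smul, hu 0, hu 1, abs_of_pos ha, abs_of_pos hb] using this
      subst hab
      have hu01 : u 0 = u 1 := smul_right_injective _ hb.ne' hne
      have hnc : (![b • u 0, b • u 1] : Fin 2 → EuclideanSpace ℝ (Fin 3)) ∉ NonCoincident 3 2 := by
        rw [mem_nonCoincident, Literature.Barriers.CriticalPhenomena.ScaleNotMoebius.injective_fin_two_iff]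
        simp [hu01]
      rw [hnorm 2 _ hnc]
  · -- inner = (true, false): symmetric
    have hk : (Finset.univ.filter fun i => inner i = true).card = 1 := by
      rw [Finset.card_eq_one]; refine ⟨0, ?_⟩; ext i; fin_cases i <;> simp [h0, h1]
    have hm : (Finset.univ.filter fun i => inner i = false).card = 1 := by
      rw [Finset.card_eq_one]; refine ⟨1, ?_⟩; ext i; fin_cases i <;> simp [h0, h1]
    rw [hk, hm, sub_self, zero_mul, Real.rpow_zero, one_mul,
      fin_two_eq (fun i => (if inner i then b else a) • u i),
      fin_two_eq (fun i => (if inner i then a else b) • u i)]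
    simp only [h0, h1, Bool.false_eq_true, if_false, if_true]
    by_cases hne : a • u 0 ≠ b • u 1
    · have h := twoPoint_exchange_of_twoPointLaw c' Δ S h2pt a b (u 0) (u 1) (hu 0) (hu 1) hne
      exact h
    · push Not at hne
      have hab : a = b := by
        have := congrArg (fun v => ‖v‖) hne
        simpa [norm_smul, hu 0, hu 1, abs_of_pos ha, abs_of_pos hb] using this
      subst hab
      have hu01 : u 0 = u 1 := smul_right_injective _ ha.ne' hne
      have hnc : (![a • u 0, a • u 1] : Fin 2 → EuclideanSpace ℝ (Fin 3)) ∉ NonCoincident 3 2 := by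
        rw [mem_nonCoincident, Literature.Barriers.CriticalPhenomena.ScaleNotMoebius.injective_fin_two_iff]
        simp [hu01]
      rw [hnorm 2 _ hnc]
  · exact exchange_of_all_inner hsc ha hb u (fun i => by fin_cases i <;> assumption)

/-! ## K1: the free members, and the reduction to the core -/

/-- **K1, free members.** Under exactly the hypotheses of the registered stub `stub_twoTimeSymmetry`, the
exchange identity holds whenever the arity is odd, or `≤ 2`, or the marking is one-shell. (The two-point-law
hypotheses `0 < c`, `P`, `ρ > 0`, translation invariance and continuity are carried verbatim from the stub and
are idle for these members.) -/
theorem stub_twoTimeSymmetry_free :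
    ∀ (Δ c : ℝ), 0 < c →
      Tendsto (fun x : Site 3 =>
        criticalTwoPoint 3 x * Real.sqrt (∑ i, ((x i : ℝ)) ^ 2) ^ (2 * Δ)) cofinite (nhds c) →
    ∀ (ρ : ℝ → ℝ) (S : CorrFamily 3), (∀ δ ∈ Set.Ioc (0 : ℝ) 1, 0 < ρ δ) →
      HasPointwiseScalingLimit (criticalCorr 3) ρ S →
      (∀ n z, z ∉ NonCoincident 3 n → S n z = 0) →
      IsTranslationInvariant S → (∀ n, ContinuousOn (S n) (NonCoincident 3 n)) →
      IsScaleCovariant Δ S →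
      (∃ c' : ℝ, 0 < c' ∧ ∀ a b : EuclideanSpace ℝ (Fin 3), a ≠ b → S 2 ![a, b] = c' * ‖a - b‖ ^ (-(2 * Δ))) →
      ∀ (n : ℕ) (a b : ℝ), 0 < a → 0 < b →
        ∀ (u : Fin n → EuclideanSpace ℝ (Fin 3)) (inner : Fin n → Bool), (∀ i, ‖u i‖ = 1) →
          (Odd n ∨ n ≤ 2 ∨ (∀ i, inner i = true) ∨ (∀ i, inner i = false)) →
          (S n (fun i => (if inner i then b else a) • u i)
          = (a / b) ^ ((((Finset.univ.filter fun i => inner i = true).card : ℝ)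
              - ((Finset.univ.filter fun i => inner i = false).card : ℝ)) * Δ)
            * S n (fun i => (if inner i then a else b) • u i)) := by
  intro Δ c _ _ ρ S _ hlim hnorm _ _ hsc h2pt n a b ha hb u inner hu hcase
  obtain ⟨c', _, h2⟩ := h2pt
  rcases hcase with hodd | hle | hin | hout
  · exact exchange_of_odd (fun k hk x => odd_eq_zero_of_limit hlim hnorm hk x) hodd a b u inner
  · -- n ≤ 2: n = 0 (one-shell, vacuously), n = 1 (odd), n = 2
    interval_cases n
    · exact exchange_of_all_inner hsc ha hb u (fun i => Fin.elim0 i)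
    · exact exchange_of_odd (fun k hk x => odd_eq_zero_of_limit hlim hnorm hk x) odd_one a b u inner
    · exact exchange_two hsc hnorm h2 ha hb u inner hu
  · exact exchange_of_all_inner hsc ha hb u hin
  · exact exchange_of_all_outer hsc ha hb u hout

/-- **K1 reduces to its core.** For a family with the K1 regularity (odd arities vanish, normalised, scale
covariant with `Δ`, two-point function `c'‖·‖^{-2Δ}`), membership in `twoShellExchange Δ` is EQUIVALENT to the
exchange identities at EVEN arities `n ≥ 4` with BOTH shells occupied — the member for which no engine exists on
this line (clause (c) of the crux restricted to two-sphere configurations). -/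
theorem mem_twoShellExchange_iff_core
    (hodd : ∀ n, Odd n → ∀ x : Fin n → EuclideanSpace ℝ (Fin 3), S n x = 0)
    (hnorm : ∀ n z, z ∉ NonCoincident 3 n → S n z = 0) (hsc : IsScaleCovariant Δ S)
    {c' : ℝ} (h2pt : ∀ p q : EuclideanSpace ℝ (Fin 3), p ≠ q → S 2 ![p, q] = c' * ‖p - q‖ ^ (-(2 * Δ))) :
    S ∈ twoShellExchange Δ ↔
      ∀ (n : ℕ), Even n → 4 ≤ n → ∀ (a b : ℝ), 0 < a → 0 < b →
        ∀ (u : Fin n → EuclideanSpace ℝ (Fin 3)) (inner : Fin n → Bool), (∀ i, ‖u i‖ = 1) →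
          (∃ i, inner i = true) → (∃ j, inner j = false) → (S n (fun i => (if inner i then b else a) • u i)
          = (a / b) ^ ((((Finset.univ.filter fun i => inner i = true).card : ℝ)
              - ((Finset.univ.filter fun i => inner i = false).card : ℝ)) * Δ)
            * S n (fun i => (if inner i then a else b) • u i)) := by
  rw [mem_twoShellExchange_iff]
  constructor
  · intro h n _ _ a b ha hb u inner hu _ _
    exact h n a b ha hb u inner hu
  · intro h n a b ha hb u inner hu
    rcases Nat.even_or_odd n with hev | hodd'
    · by_cases h4 : 4 ≤ n
      · by_cases hin : ∃ i, inner i = true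
        · by_cases hout : ∃ j, inner j = false
          · exact h n hev h4 a b ha hb u inner hu hin hout
          · push Not at hout
            exact exchange_of_all_inner hsc ha hb u (fun i => by simpa using hout i)
        · push Not at hin
          exact exchange_of_all_outer hsc ha hb u (fun i => by simpa using hin i)
      · -- even n < 4: n = 0 or n = 2
        push Not at h4
        interval_cases n
        · exact exchange_of_all_inner hsc ha hb u (fun i => Fin.elim0 i)
        · exact absurd hev (by decide)
        · exact exchange_two hsc hnorm h2pt ha hb u inner hu
        · exact absurd hev (by decide)
    · exact exchange_of_odd hodd hodd' a b u inner

end Summit.CriticalPhenomena.Ising3DConformalLimit.PrecisionLaplacianMoebiusLimitOfTwoPointLaw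

end
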